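import Mathlib.RingTheory.PowerSeries.Inverse
import Mathlib.Topology.Algebra.InfiniteSum.Basic
import Literature.NumberTheory.EllipticCurves.PAdicLFunction
import Literature.NumberTheory.EllipticCurves.Isogeny
import HarnessLib

/-!
# Overconvergent modular symbols of weight two (`k = 0`) on `Γ₀(Np)`: the moment model of `𝐃`, the
# `S₀(p)`-action, Hecke operators, specialisation, the critical-slope refinement `φ_β`, and the named
# facts (Stevens' control theorem at slope `< 1`; the critical-slope eigen-lift `Φ_β` of
# Pollack–Stevens / Bellaïche); the critical `p`-adic `L`-function as the coset moments of
# `Φ_β({∞} − {0})`, with its interpolation property PROVED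

Topic `Literature/NumberTheory/EllipticCurves`; definition item `defn-OverconvergentModularSymbolsWeightTwo`
= D5′ of the BSD route `SlopeDichotomyA2` (cell `bsd-schneider-ideate`, planner memo
`ROUTE-P3-D5prime-wt2OMS-g17.md`: the weight-two, `Γ₀(Np)` NARROWING of D5
`defn-OverconvergentModularSymbols`, blocked twice as an XL typing programme; consumers: D1
`defn-CriticalSlopePAdicLFunction`, then the β-cruxes `stmt-BirchSwinnertonDyer-19171/19172` under
`stmt-BirchSwinnertonDyer-19086`).  Written by seat `pub-hodgecm2-infra07f1` gen 72 (THE PASS), whose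
gen 69 recommended exactly this narrowing.  DEFINITIONS with bodies + proved API + THREE cite-only named
facts (`def … : Prop`, nothing asserted; D-0014/D-0026 accounting: +3, each one requested by the item);
no `sorry`, no instance, no notation.  HONEST FRAMING: nothing here bears on BSD; the facts are inputs
that make the β-road TYPEABLE, and `SpecializeInjOnEigenspace` (non-`θ`-criticality) is a HYPOTHESIS.

## Sources (held; pages read by this seat)

* [PollackStevens2011] R. Pollack, G. Stevens, *Overconvergent modular symbols and `p`-adic
  `L`-functions*, Ann. Sci. ÉNS 44 (2011) 1–42 (store `paper:galaxy-pdf-7972659087883370800`; PDF pages):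
  §2.1 p. 7 «Let `Δ₀ := Div⁰(ℙ¹(ℚ))` … `(φ|γ)(D) := φ(γD)|γ` … `φ ∈ Symb_Γ(V) ⟺ φ(γD) = φ(D)|γ⁻¹` for
  all `γ ∈ Γ`»; p. 8 «`φ|T_ℓ = φ|(ℓ 0; 0 1) + ∑_{a=0}^{ℓ−1} φ|(1 a; 0 ℓ)` … `φ|U_q = ∑_{a=0}^{q−1} φ|(1 a;
  0 q)`», the involution `(−1 0; 0 1)` and `Symb^±`; §3.1 p. 17 «`𝐀[r] = {∑ aₙzⁿ : |aₙ|·rⁿ → 0}`», `𝐃[r]` its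
  dual, `𝐃 = 𝐃[1]`; §3.2 **Prop. 3.1** p. 18 «(1) The image of `M` [the moment map] equals `{(c_j) : |c_j| is
  O(rʲ) for each r > 1}`. (2) The map `M` restricts to give an isomorphism of Banach spaces between `𝐃`
  and the space of bounded sequences in `ℚ_p`»; §3.3 pp. 18–19 «`Σ₀(p) = {(a b; c d) ∈ M₂(ℤ_p) : p ∤ a,
  p ∣ c, ad − bc ≠ 0}` … `(γ ·_k f)(z) = (a + cz)^k f((b + dz)/(a + cz))` … `(μ|_k γ)(f) = μ(γ ·_k f)`»;
  §3.4 p. 19 `ρ_k : D_k → V_k`, `μ ↦ ∫(Y − zX)^k dμ` («`Σ₀(p)`-equivariant»); §5 pp. 21–22 «we refer to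
  `Symb_{Γ₀}(D_k)` as a space of overconvergent modular symbols … `ρ_k^*` … the specialization map … is
  Hecke-equivariant»; **Thm. 5.12** p. 27 «`Symb_{Γ₀}(𝒟_k(ℤ_p))^{(<k+1)} → Symb_{Γ₀}(𝐃_k)^{(<k+1)} →
  Symb_{Γ₀}(V_k)^{(<k+1)}` is an isomorphism. That is, the specialization map restricted to the subspace
  where `U_p` acts with slope strictly less than `k+1` is an isomorphism» (`Γ₀ = Γ ∩ Γ₀(p)`, `Γ` of level
  `N`, `p ∤ N`, §4 p. 19); **Thm. 5.14** p. 28 «Let `f` be an eigenform of `S_{k+2}(Γ₀)` with slope `k+1`.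
  Then `Symb_{Γ₀}(𝐃_k)_{(f)} ⥲ Symb_{Γ₀}(V_k)_{(f)}` is an isomorphism if and only if `f ∉ im(θ_k)`» (from
  [PollackStevens2013]); **Rem. 5.15 (2)** «If `f` is the critical slope `p`-stabilization of a
  `p`-ordinary CM modular form, then `f` is in the image of `θ_k`»; **Prop. 6.3** pp. 30–31 (slope `< k+1`:
  `Φ_f({∞} − {0})|_{ℤ_p^×} = μ_f`, proof: «`Φ = α⁻ⁿ Φ|U_pⁿ` … the support of `μ|β(a,pⁿ)` is contained in
  `a + pⁿℤ_p` … `Φ({∞} − {0})(zʲ·1_{a+pⁿℤ_p}) = α⁻ⁿ Φ({∞} − {a/pⁿ})((pⁿz + a)ʲ)`»); §6.4 **Def. 6.4** p. 31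
  «Let `f` be an eigenform … of slope `k+1` which is not in the image of `θ_k`. Let `Φ_f` be the unique
  overconvergent eigensymbol (of Theorem 5.14) which specializes to `φ_f`. We define the `p`-adic
  `L`-function of `f` to be `μ_f := Φ_f({∞} − {0})|_{ℤ_p^×}`» after «the interpolation property (1) does not
  uniquely determine a `(k+1)`-admissible distribution»; **Prop. 6.5** p. 31 «`μ_f(zʲ·χ) = β⁻ⁿ ·
  p^{n(j+1)}/(−2πi)ʲ · j!/τ(χ⁻¹) · L(f, χ⁻¹, 1)/Ω_f^±` … a formal consequence of the fact that `Φ_f` is a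
  `U_p`-eigensymbol lifting `φ_f`»; §9.1 p. 41 (power series in the cyclotomic variable).
* [Bellaiche2012] J. Bellaïche, *Critical `p`-adic `L`-functions*, Invent. Math. 189 (2012)
  (store `paper:arxiv-0912.2925`): **Def. 1** p. 5 «decent: (i) `f` Eisenstein (ii) `f_β` non-critical
  (iii) `f` cuspidal and `H¹_g(G_ℚ, ρ_f) = 0`»; **Thm. 1** p. 5 «Let `f` be a newform of weight `k+2` and
  level `Γ₁(N)` … `f_β` decent … Then for both choices of the sign `±`, the eigenspace `Symb_Γ^±(𝒟_k)[f_β]`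
  has dimension `1`. Moreover TFAE (i) `f_β` is critical (ii) the generalized eigenspaces have dimension
  `> 1` (iii) (TS±) `ρ_k^*(Symb_Γ^±(𝒟_k)[f_β]) = 0`»; **Prop. 2.12** pp. 12–13 (critical ⟺ `v_p(β) > 0` and
  `ρ_f|_{D_p}` is the direct sum of two characters; for cuspidal `f`, ⟺ (v) `f_β ∈ im θ_k`); **Prop. 2.14**
  p. 13 ((a) non-CM ordinary: non-criticality «expected, but not known»; (b) CM, `p` split: «always
  critical»); **Prop. 2.15** p. 13 («(iii) the form `f` is not CM, and `f` is cuspidal or special at all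
  primes dividing `N` (e.g. `f` is of trivial nebentypus and `N` is square-free). (iv) The form `f` is CM.»
  ⟹ `H¹_f(G_ℚ, ad ρ_f) = 0`, «in particular `f_β` is decent»).
* [MazurTateTeitelbaum1986Invent] §I.4 (4.2), §I.10 (10.1): the tree's `ratPlusSymbol`, `msdMeasure`.

## Transcription (three simplifications available at `k = 0`, as the item prescribes)

1. `Δ₀` has the `ℤ`-basis `{∞} − {r}`, `r ∈ ℚ`: a symbol is a FUNCTION `Φ : ℚ → V` (the values
   `Φ({∞} − {r})`, `Φ({∞} − {∞}) = 0`), exactly as the tree's classical `modularSymbol f : ℚ → ℂ`; PS's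
   invariance `φ|γ = φ`, `(φ|γ)(D) = φ(γD)|γ`, reads `Φ(r) = (Φ(γr) − Φ(γ∞))|γ` (`slash`, `OMSymb.slash_eq`).
2. Weight `0`: `(γ ·₀ f)(z) = f((b + dz)/(a + cz))`, no polynomial twist; `V₀ = ℚ_p` with the trivial action.
3. MOMENT MODEL (Prop. 3.1): a distribution is its moment sequence `ℕ → ℚ_p` (`Dist`), `𝐃` = the bounded
   ones (`Dist.IsBounded`); `(μ|₀γ)(zʲ) = ∑ₙ [zⁿ]((b + dz)/(a + cz))ʲ · μ(zⁿ)` with the coefficients read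
   off the power series `((b + dX)(a + cX)⁻¹)ʲ ∈ ℚ_p⟦X⟧` (`moebiusPowSeries`, Mathlib `PowerSeries` with its
   inverse over a field) and the sum a `tsum` (`Dist.act`) — convergent for `μ ∈ 𝐃`, `γ ∈ S₀(p)`
   (coefficients `→ 0` since `p ∣ c`, `a ∈ ℤ_p^×`), a FINITE sum for the upper-triangular matrices
   `(1 u; 0 q)` of all Hecke operators at `p` and all coset evaluations (`act_heckeMat`, proved).  Only
   integer matrices are needed (`S₀(p) = Σ₀(p) ∩ M₂(ℤ)`, §2.1), so `γ : Matrix (Fin 2) (Fin 2) ℤ` throughout.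

| item | Lean | status |
|---|---|---|
| O1 `𝐃`, weight-0 action, `ρ₀` | `Dist`, `Dist.IsBounded`, `moebiusPowSeries`, `Dist.act`, `Dist.totalMass` | defs; `act_apply_zero` (= `ρ₀` equivariant), `act_heckeMat`, `zero_act` proved |
| O2 `Symb_{Γ₀(M)}(𝐃)`, `Symb_{Γ₀(M)}(ℚ_p)` | `moebius`, `extInfty`, `slash`, `slash₀`, `OMSymb`, `MSymb` (+ `.zero`, `OMSymb.smul`) | defs; `slash_smul`, `smul_act` proved |
| O3 `U_p`, `T_ℓ`, `ι` | `heckeMat`, `Up`, `Tl`, `invol`, `Up₀`, `Tl₀`, `invol₀` (on value functions) | defs |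
| O4 specialisation | `specializeFun`, `specialize : OMSymb → MSymb` | def + `specializeFun_slash/_Up/_Tl/_invol` proved (Hecke-equivariance) |
| O5 `φ_W`, `φ_β` | `phiClassical`, `phiBeta` | defs; `cosetMoments_apply_zero_eq_msdMeasure` proved (the item's consistency check `β⁻ⁿφ_β(a/pⁿ) = msdMeasure f β n a`) |
| F1₀ control, slope `< 1` | `stevensControl_slope_lt_one` | named fact [PS Thm 5.12] |
| F2₀(a) `dim = 1` | `bellaiche2012_thm1_eigenspace_dim_one` | named fact [Bel12 Thm 1 + Prop 2.15 (iii)/(iv)] |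
| F2₀(b) critical lift `Φ_β` | `SpecializeInjOnEigenspace` (hypothesis), `pollackStevens_criticalSlope_eigenLift`, `IsEigenLift.unique` | named fact [PS Thm 5.14, Def 6.4] + uniqueness PROVED |
| F2₀(c) CM ⇒ `θ`-critical | docstring of `SpecializeInjOnEigenspace` (PS Rem 5.15 (2), Bel12 Prop 2.14 (b)) | warning, not a decl |
| F3₀ `μ_{f_β}` and its interpolation | `cosetMoments`, `criticalPAdicLDist`, `charValue`; `charValue_eq_of_specializeFun_eq` | defs + Prop 6.5 (`k = j = 0`) PROVED from `ρ₀^*(Φ) = φ_β` |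

## Design notes / scope

* The Hecke operators are defined on VALUE FUNCTIONS `ℚ → 𝐃` (resp. `ℚ → ℚ_p`), and eigen-conditions are
  equations between value functions (`IsEigen`, `IsEigenLift`); that they preserve `Symb_{Γ₀(M)}` is not
  needed by any statement here and not proved (it needs the associativity `(μ|γ)|γ′ = μ|γγ′` of the power
  series action, i.e. rearrangement of the double `tsum`).  Likewise no `Module` instance on `OMSymb`
  (statement files declare no instances); "one-dimensional" is spelled out (`∃ Φ₀ ≠ 0, ∀ Φ, ∃ c, Φ = c • Φ₀`).
* `Dist.act` is a `tsum` with Mathlib's junk value `0` off summability; every use in this file's theorems is a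
  finite sum.  `moebiusPowSeries` uses `(a + cX)⁻¹` in `ℚ_p⟦X⟧` (junk when `a = 0`, never the case in `S₀(p)`).
* `SpecializeInjOnEigenspace W N β` ("`ρ₀^*` is injective on `Symb_{Γ₀(Np)}(𝐃)^+[f_β]`") is the tree's
  stand-in for «`f_β ∉ im θ_k`» / «`ρ_f|_{D_p}` non-split» (equivalent for decent cuspidal `f_β` by Bel12
  Thm 1 (i)⇔(iii) + Prop 2.12; the overconvergent `θ`-operator and `D_cris` are not in the tree).  It FAILS
  for CM curves (PS Rem 5.15 (2); Bel12 Prop 2.14 (b) + Thm 1 (iii)) and is EXPECTED, NOT KNOWN, for non-CM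
  ordinary `W` (Bel12 Prop 2.14 (a): Greenberg's question) — never assert "non-CM ⇒ non-split".
* Only the PLUS symbol / sign `+` (the tree has `ratPlusSymbol` only); values at odd characters are not
  touched.  Only `α, β ∈ ℚ_p` (ordinary `p`: the roots of `X² − a_pX + p` lie in `ℤ_p`).
* NOT here (item's exclusions): general weight, `Γ₁(N)`, slope decompositions, overconvergent FORMS and
  `θ_k`, the eigencurve, two-variable `L`-functions; and NOT the power series `L_p(f_β, T)` in the
  cyclotomic variable — that is D1 (`defn-CriticalSlopePAdicLFunction`), which must integrate the Mahler
  functions of `log_γ⟨x⟩` against ALL coset moments `criticalPAdicLDist` (PS §9.1–9.2): the distribution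
  is `1`-admissible, NOT a measure, so Riemann sums of its values on compact opens (the tree's
  `padicLRiemannSum` recipe for the unit root) do NOT define it (PS §6.4).
* Mathlib/tree search: `lean search` for `overconvergent`, `OMS`, `Symb_`, `modular symbol.*distribution`,
  `admissible distribution` — nothing beyond the tree's `ModularSymbols.lean`/`PAdicLFunction.lean`
  (classical symbols, MTT measure) and Mathlib's `PowerSeries`, `Padic`, `DirichletCharacter`.
-/

noncomputable section

open scoped MatrixGroups ModularForm
open CongruenceSubgroup PowerSeries Literature.NumberTheory.EllipticCurves.ModularForms

namespace Literature.NumberTheory.EllipticCurves.OMSWeightTwo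

variable (p : ℕ) [Fact p.Prime]

/-! ## §1 Distributions on `ℤ_p` in the moment model and the weight-`0` action of `S₀(p)` -/

/-- A `p`-adic distribution on `ℤ_p` in the MOMENT MODEL: the sequence of its moments
`j ↦ μ(zʲ)`.  By [PollackStevens2011, Prop. 3.1] the moment map `μ ↦ (μ(zʲ))_j` identifies
`𝒟†(ℤ_p, 1)` with the sequences that are `O(rʲ)` for every `r > 1`, and (part (2)) the Banach space
`𝐃 = 𝐃[1]` (dual of the Tate algebra `𝐀[1]`) ISOMETRICALLY with the bounded sequences; we work with
all sequences and single out `𝐃` by the predicate `IsBounded`.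
[cite: PollackStevens2011, §3.2 Prop. 3.1 (p. 18)] -/
abbrev Dist : Type := ℕ → ℚ_[p]

variable {p}

/-- `μ ∈ 𝐃`: the moments are bounded (Prop. 3.1 (2): `‖μ‖₁ = sup_j |μ(zʲ)|`).
[cite: PollackStevens2011, §3.2 Prop. 3.1 (2) (p. 18)] -/
def Dist.IsBounded (μ : Dist p) : Prop := ∃ C : ℝ, ∀ j, ‖μ j‖ ≤ C

/-- The total mass / weight-`0` specialisation `ρ₀(μ) = μ(1) = μ(z⁰) ∈ V₀ = ℚ_p` (the map
`ρ_k : D_k → V_k`, `μ ↦ ∫ (Y − zX)^k dμ`, at `k = 0`). [cite: PollackStevens2011, §3.4 (p. 19), ρ_k at k = 0] -/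
def Dist.totalMass (μ : Dist p) : ℚ_[p] := μ 0

/-- The power series `((b + d·z)/(a + c·z))ʲ ∈ ℚ_p⟦z⟧` of an integer matrix `γ = (a b; c d)` with
`a ≠ 0`: the `j`-th power of the Möbius transform `(γ ·₀ zʲ)`, whose `n`-th coefficient is the weight of
the `n`-th moment in `(μ|₀γ)(zʲ) = μ((γ ·₀ z)ʲ)` (weight-`0` action `(γ ·₀ f)(z) = f((b + dz)/(a + cz))`).
For `γ ∈ S₀(p)` (`p ∤ a`, `p ∣ c`) the coefficients lie in `ℤ_p` and tend to `0`.
[cite: PollackStevens2011, §3.3 (pp. 18–19), the weight-k action at k = 0] -/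
def moebiusPowSeries (γ : Matrix (Fin 2) (Fin 2) ℤ) (j : ℕ) : PowerSeries ℚ_[p] :=
  ((C (γ 0 1 : ℚ_[p]) + C (γ 1 1 : ℚ_[p]) * X) * (C (γ 0 0 : ℚ_[p]) + C (γ 1 0 : ℚ_[p]) * X)⁻¹) ^ j

/-- **The weight-`0` right action of `S₀(p)` on distributions** in the moment model:
`(μ|₀γ)(zʲ) = μ(((b + dz)/(a + cz))ʲ) = ∑ₙ [zⁿ]((b + dz)/(a + cz))ʲ · μ(zⁿ)` — a convergent series
for `μ ∈ 𝐃` and `γ ∈ S₀(p)` (coefficients `→ 0`), a finite sum when `c = 0` (all Hecke matrices at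
`p`); `tsum` junk (`0`) where the series diverges. [cite: PollackStevens2011, §3.3 (p. 19): "(μ|_k γ)(f) = μ(γ ·_k f)"] -/
def Dist.act (μ : Dist p) (γ : Matrix (Fin 2) (Fin 2) ℤ) : Dist p :=
  fun j => ∑' n : ℕ, coeff n (moebiusPowSeries (p := p) γ j) * μ n

/-! ## §2 Modular symbols as functions on `ℚ` (values on the divisors `{∞} − {r}`) -/

/-- The Möbius action of an integer matrix on `ℙ¹(ℚ) = ℚ ∪ {∞}` (`none` = `∞`):
`γ · r = (a r + b)/(c r + d)` (`= ∞` when `c r + d = 0`), `γ · ∞ = a/c` (`= ∞` when `c = 0`).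
[cite: PollackStevens2011, §2.1 (p. 7): "GL₂(ℚ) acts via linear fractional transformations"] -/
def moebius (γ : Matrix (Fin 2) (Fin 2) ℤ) : Option ℚ → Option ℚ
  | some r => if (γ 1 0 : ℚ) * r + γ 1 1 = 0 then none
      else some (((γ 0 0 : ℚ) * r + γ 0 1) / ((γ 1 0 : ℚ) * r + γ 1 1))
  | none => if γ 1 0 = 0 then none else some ((γ 0 0 : ℚ) / (γ 1 0 : ℚ))

/-- Extension of a function on `ℚ` (the values `Φ({∞} − {r})`) to `ℙ¹(ℚ)` by `Φ({∞} − {∞}) = 0`.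
[cite: PollackStevens2011, §2.1 (p. 7)] -/
def extInfty {V : Type*} [Zero V] (Φ : ℚ → V) : Option ℚ → V
  | some r => Φ r
  | none => 0

/-- **The slash action of `γ ∈ S₀(p)` on `𝐃`-valued functions of `{∞} − {r}`**:
`(Φ|γ)({∞} − {r}) = Φ(γ({∞} − {r}))|γ = (Φ({∞} − {γr}) − Φ({∞} − {γ∞}))|₀γ`, i.e. PS's
`(φ|γ)(D) := φ(γD)|γ` written on the `ℤ`-basis `{∞} − {r}` of `Δ₀ = Div⁰(ℙ¹(ℚ))`.
[cite: PollackStevens2011, §2.1 (p. 7): "(φ|γ)(D) := φ(γD)|γ"] -/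
def slash (Φ : ℚ → Dist p) (γ : Matrix (Fin 2) (Fin 2) ℤ) : ℚ → Dist p :=
  fun r => (extInfty Φ (moebius γ (some r)) - extInfty Φ (moebius γ none)).act γ

/-- The slash action on SCALAR-valued (classical, weight `0`: `V₀ = ℚ_p` with the trivial action)
functions of `{∞} − {r}`: `(φ|γ)({∞} − {r}) = φ({∞} − {γr}) − φ({∞} − {γ∞})`.
[cite: PollackStevens2011, §2.1 (p. 7) and §3.4 (p. 19): V_k at k = 0] -/
def slash₀ (φ : ℚ → ℚ_[p]) (γ : Matrix (Fin 2) (Fin 2) ℤ) : ℚ → ℚ_[p] :=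
  fun r => extInfty φ (moebius γ (some r)) - extInfty φ (moebius γ none)

/-- **Overconvergent modular symbols of weight two and level `Γ₀(M)`** (`p ∣ M` understood, so that
`Γ₀(M) ≤ S₀(p)`), `Symb_{Γ₀(M)}(𝐃)` in the moment model: a function `Φ : ℚ → 𝐃` (the values
`Φ({∞} − {r})`, bounded moment sequences) invariant under `Γ₀(M)`: `Φ|γ = Φ`, i.e.
`Φ({∞} − {r}) = (Φ({∞} − {γr}) − Φ({∞} − {γ∞}))|₀γ` for all `γ ∈ Γ₀(M)`.
[cite: PollackStevens2011, §2.1 (p. 7) "φ ∈ Symb_Γ(V) ⟺ φ|γ = φ for all γ ∈ Γ" and §5 (p. 21) "Symb_{Γ₀}(D_k) … overconvergent modular symbols"] -/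
structure OMSymb (p : ℕ) [Fact p.Prime] (M : ℕ) where
  /-- the values `Φ({∞} − {r})`, `r ∈ ℚ` -/
  toFun : ℚ → Dist p
  /-- values in `𝐃`: bounded moments -/
  isBounded : ∀ r, (toFun r).IsBounded
  /-- `Γ₀(M)`-invariance `Φ|γ = Φ` -/
  slash_eq : ∀ γ : SL(2, ℤ), γ ∈ Gamma0 M → slash toFun (γ : Matrix (Fin 2) (Fin 2) ℤ) = toFun

/-- **Classical modular symbols of weight two and level `Γ₀(M)`** with values in `V₀ = ℚ_p`
(trivial action), `Symb_{Γ₀(M)}(ℚ_p)`: `φ({∞} − {r}) = φ({∞} − {γr}) − φ({∞} − {γ∞})` for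
`γ ∈ Γ₀(M)` — the same encoding as the tree's `modularSymbol f : ℚ → ℂ` (`{∞, r}`).
[cite: PollackStevens2011, §2.1 (p. 7) and §3.4 (p. 19), V_k-valued symbols at k = 0] -/
structure MSymb (p : ℕ) [Fact p.Prime] (M : ℕ) where
  /-- the values `φ({∞} − {r})`, `r ∈ ℚ` -/
  toFun : ℚ → ℚ_[p]
  /-- `Γ₀(M)`-invariance -/
  slash₀_eq : ∀ γ : SL(2, ℤ), γ ∈ Gamma0 M → slash₀ toFun (γ : Matrix (Fin 2) (Fin 2) ℤ) = toFun

/-! ## §3 Hecke operators and the involution (on the value functions) -/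

/-- The matrix `(1 u; 0 q)`. [cite: PollackStevens2011, §2.1 (p. 8): "φ|U_q = ∑_{a=0}^{q-1} φ|(1 a; 0 q)"] -/
def heckeMat (u q : ℤ) : Matrix (Fin 2) (Fin 2) ℤ := !![1, u; 0, q]

/-- **`U_p`** on `𝐃`-valued functions: `Φ|U_p = ∑_{u=0}^{p−1} Φ|(1 u; 0 p)`, i.e.
`(Φ|U_p)({∞} − {r}) = ∑_u Φ({∞} − {(r+u)/p})|₀(1 u; 0 p)`.
[cite: PollackStevens2011, §2.1 (p. 8)] -/
def Up (Φ : ℚ → Dist p) : ℚ → Dist p :=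
  fun r => ∑ u ∈ Finset.range p, slash Φ (heckeMat u p) r

/-- **`T_ℓ`** (`ℓ ∤ M`) on `𝐃`-valued functions: `Φ|T_ℓ = Φ|(ℓ 0; 0 1) + ∑_{a=0}^{ℓ−1} Φ|(1 a; 0 ℓ)`.
[cite: PollackStevens2011, §2.1 (p. 8)] -/
def Tl (ℓ : ℕ) (Φ : ℚ → Dist p) : ℚ → Dist p :=
  fun r => slash Φ !![(ℓ : ℤ), 0; 0, 1] r + ∑ a ∈ Finset.range ℓ, slash Φ (heckeMat a ℓ) r

/-- The involution `ι = (−1 0; 0 1)`: `(Φ|ι)({∞} − {r}) = Φ({∞} − {−r})|₀ι`; its `±1`-eigenspaces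
are `Symb^±`. [cite: PollackStevens2011, §2.1 (p. 8)] -/
def invol (Φ : ℚ → Dist p) : ℚ → Dist p := slash Φ !![-1, 0; 0, 1]

/-- `U_p` on classical (scalar) value functions: `(φ|U_p)(r) = ∑_{u=0}^{p−1} φ((r + u)/p)`.
[cite: PollackStevens2011, §2.1 (p. 8)] -/
def Up₀ (φ : ℚ → ℚ_[p]) : ℚ → ℚ_[p] :=
  fun r => ∑ u ∈ Finset.range p, slash₀ φ (heckeMat u p) r

/-- `T_ℓ` on classical value functions. [cite: PollackStevens2011, §2.1 (p. 8)] -/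
def Tl₀ (ℓ : ℕ) (φ : ℚ → ℚ_[p]) : ℚ → ℚ_[p] :=
  fun r => slash₀ φ !![(ℓ : ℤ), 0; 0, 1] r + ∑ a ∈ Finset.range ℓ, slash₀ φ (heckeMat a ℓ) r

/-- The involution on classical value functions: `(φ|ι)(r) = φ(−r)`. [cite: PollackStevens2011, §2.1 (p. 8)] -/
def invol₀ (φ : ℚ → ℚ_[p]) : ℚ → ℚ_[p] := slash₀ φ !![-1, 0; 0, 1]

/-! ## §4 Specialisation `ρ₀^*` -/

/-- **The specialisation map on value functions**: `ρ₀^*(Φ)({∞} − {r}) = ρ₀(Φ({∞} − {r}))`, the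
total mass. [cite: PollackStevens2011, §5 (pp. 21–22): "ρ_k^* : Symb_{Γ₀}(D_k) → Symb_{Γ₀}(V_k) … the specialization map"] -/
def specializeFun (Φ : ℚ → Dist p) : ℚ → ℚ_[p] := fun r => (Φ r).totalMass

/-! ## §5 The classical plus symbol of an elliptic curve and its critical-slope `p`-stabilisation -/

section Classical

variable {N : ℕ} (f : CuspForm (Gamma0 N) 2)

/-- The classical PLUS modular symbol of `f` read in `ℚ_p`: `φ_f(r) = [r]⁺_f = ratPlusSymbol f r`
(tree `PAdicLFunction.lean`; `[0]⁺ = L(f,1)/Ω⁺`). [cite: MazurTateTeitelbaum1986Invent, §I.8]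
[cite: PollackStevens2011, §6.3 (p. 30), φ_f^± at k = 0] -/
def phiClassical : ℚ → ℚ_[p] := fun r => (ratPlusSymbol f r : ℚ_[p])

/-- **The `p`-stabilised plus symbol `φ_β = φ_f − β⁻¹ φ_f|(p 0; 0 1)`** of the refinement `f_β`:
`φ_β(r) = [r]⁺ − β⁻¹ [p r]⁺`, a `U_p`-eigensymbol of level `Γ₀(Np)` with eigenvalue `β` when
`β² − a_p β + p = 0` (MTT (4.2): `a_p [r]⁺ = ∑_u [(r+u)/p]⁺ + [p r]⁺`).  For `p` good ordinary and
`v_p(β) = 1` this is the CRITICAL-slope refinement. [cite: PollackStevens2011, §8 (p. 39) "φ_β" and Def. 6.4 (p. 31)]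
[cite: MazurTateTeitelbaum1986Invent, §I.10 (10.1) and §I.4 (4.2)] -/
def phiBeta (β : ℚ_[p]) : ℚ → ℚ_[p] :=
  fun r => (ratPlusSymbol f r : ℚ_[p]) - β⁻¹ * (ratPlusSymbol f (p * r) : ℚ_[p])

end Classical

/-! ## §6 Eigen-packages and the coset moments of `Φ({∞} − {0})` -/

/-- **`Φ` is a Hecke eigen-lift for the refinement `(f, β)` of the newform `f` of `W` at level
`Γ₀(Np)`, plus part**: `Φ ∈ Symb_{Γ₀(Np)}(𝐃)^+` (`Φ|ι = Φ`), `Φ|U_p = β Φ`, `Φ|T_ℓ = a_ℓ(W) Φ` for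
primes `ℓ ∤ Np` (`a_ℓ(W) = a_ℓ(f)` by `IsNewformOf`), and `ρ₀^*(Φ) = φ_β`. [cite: PollackStevens2011, Def. 6.4 (p. 31): "the unique overconvergent eigensymbol (of Theorem 5.14) which specializes to φ_f"]
[cite: Bellaiche2012, Thm. 1 (p. 5): the eigenspace Symb_Γ^±(𝒟_k)[f_β]] -/
structure IsEigenLift (W : WeierstrassCurve ℚ) {N : ℕ} (f : CuspForm (Gamma0 N) 2) (β : ℚ_[p])
    (Φ : OMSymb p (N * p)) : Prop where
  invol_eq : invol Φ.toFun = Φ.toFun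
  up_eq : Up Φ.toFun = β • Φ.toFun
  tl_eq : ∀ ℓ : ℕ, ℓ.Prime → ¬ ℓ ∣ N * p → Tl ℓ Φ.toFun = (W.LFunction ℓ : ℚ_[p]) • Φ.toFun
  specialize_eq : specializeFun Φ.toFun = phiBeta f β

/-- **`Φ` lies in the eigenspace `Symb_{Γ₀(Np)}(𝐃)^+[f_β]`** of the refinement `f_β` of the newform
of `W` (eigenvalues `a_ℓ(W)` off `Np`, `β` at `p`; no condition on the specialisation). [cite: Bellaiche2012, Thm. 1 (p. 5)] -/
structure IsEigen (W : WeierstrassCurve ℚ) (N : ℕ) (β : ℚ_[p]) (Φ : OMSymb p (N * p)) :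
    Prop where
  invol_eq : invol Φ.toFun = Φ.toFun
  up_eq : Up Φ.toFun = β • Φ.toFun
  tl_eq : ∀ ℓ : ℕ, ℓ.Prime → ¬ ℓ ∣ N * p → Tl ℓ Φ.toFun = (W.LFunction ℓ : ℚ_[p]) • Φ.toFun

/-- **The coset moments of `μ = Φ({∞} − {0})` on `ℤ_p^×`, for a `U_p`-eigensymbol of eigenvalue
`β ≠ 0`**: for `n ≥ 1` and `a ∈ (ℤ/pⁿ)` (represented by `a.val ∈ [0, pⁿ)`),
`(∫_{a + pⁿℤ_p} zʲ dμ)_j = β⁻ⁿ · Φ({∞} − {a/pⁿ})|₀(1 a; 0 pⁿ)`, i.e.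
`∫_{a+pⁿℤ_p} g dμ = β⁻ⁿ Φ({∞} − {a/pⁿ})(g(a + pⁿz))` — the formula by which Pollack–Stevens EVALUATE
`Φ_f({∞} − {0})` (proof of Prop. 6.3: `Φ = α⁻ⁿ Φ|U_pⁿ`, "the support of `μ|β(a,pⁿ)` is contained in
`a + pⁿℤ_p`") and define the critical `p`-adic `L`-function `μ_f := Φ_f({∞} − {0})|_{ℤ_p^×}` (Def. 6.4;
restricting to `ℤ_p^×` = using only `a` prime to `p`).  Level `n = 0` is not used (`ℤ_p^×` is covered at
level `1`). [cite: PollackStevens2011, Prop. 6.3 proof (pp. 30–31) and Def. 6.4 (p. 31); §9.1 (p. 41)] -/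
def cosetMoments (Φ : ℚ → Dist p) (β : ℚ_[p]) (n : ℕ) (a : ZMod (p ^ n)) : Dist p :=
  β⁻¹ ^ n • (Φ ((a.val : ℚ) / (p : ℚ) ^ n)).act (heckeMat (a.val : ℤ) ((p : ℤ) ^ n))

/-! ## §7 Proved API: specialisation is `S₀(p)`-equivariant; upper-triangular matrices act by finite sums -/

/-- The `0`-th power series is `1`. [cite: PollackStevens2011, §3.3 (p. 19)] -/
theorem moebiusPowSeries_zero (γ : Matrix (Fin 2) (Fin 2) ℤ) :
    moebiusPowSeries (p := p) γ 0 = 1 := by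
  simp [moebiusPowSeries]

/-- **`ρ₀` is `S₀(p)`-equivariant** (weight `0`: `V₀ = ℚ_p` carries the trivial action): the total
mass of `μ|₀γ` is the total mass of `μ`, `(μ|₀γ)(1) = μ(γ ·₀ 1) = μ(1)`.
[cite: PollackStevens2011, §3.4 (p. 19): "there is a Σ₀(p)-equivariant map ρ_k : D_k → V_k"] -/
theorem act_apply_zero (μ : Dist p) (γ : Matrix (Fin 2) (Fin 2) ℤ) : μ.act γ 0 = μ 0 := by
  unfold Dist.act
  rw [moebiusPowSeries_zero, tsum_eq_single 0]
  · simp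
  · intro n hn
    simp [PowerSeries.coeff_one, hn]

/-- Total mass of `μ|₀γ`. [cite: PollackStevens2011, §3.4 (p. 19)] -/
theorem totalMass_act (μ : Dist p) (γ : Matrix (Fin 2) (Fin 2) ℤ) :
    (μ.act γ).totalMass = μ.totalMass :=
  act_apply_zero μ γ

/-- `extInfty` commutes with the total mass. [cite: PollackStevens2011, §2.1 (p. 7)] -/
theorem totalMass_extInfty (Φ : ℚ → Dist p) (x : Option ℚ) :
    (extInfty Φ x).totalMass = extInfty (specializeFun Φ) x := by
  cases x <;> rfl

/-- **The specialisation map is compatible with the slash actions**: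
`ρ₀^*(Φ|γ) = ρ₀^*(Φ)|γ`. [cite: PollackStevens2011, §5 (p. 22): "ρ_k^* is Hecke-equivariant as ρ_k is Σ₀(p)-equivariant"] -/
theorem specializeFun_slash (Φ : ℚ → Dist p) (γ : Matrix (Fin 2) (Fin 2) ℤ) :
    specializeFun (slash Φ γ) = slash₀ (specializeFun Φ) γ := by
  funext r
  change ((extInfty Φ (moebius γ (some r)) - extInfty Φ (moebius γ none)).act γ) 0 =
    extInfty (specializeFun Φ) (moebius γ (some r)) - extInfty (specializeFun Φ) (moebius γ none)
  rw [act_apply_zero, Pi.sub_apply, ← totalMass_extInfty, ← totalMass_extInfty]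
  rfl

/-- `ρ₀^*` commutes with `U_p`. [cite: PollackStevens2011, §5 (p. 22)] -/
theorem specializeFun_Up (Φ : ℚ → Dist p) : specializeFun (Up Φ) = Up₀ (specializeFun Φ) := by
  funext r
  change (∑ u ∈ Finset.range p, slash Φ (heckeMat u p) r) 0 = ∑ u ∈ Finset.range p, _
  rw [Finset.sum_apply]
  exact Finset.sum_congr rfl fun u _ => congrFun (specializeFun_slash Φ (heckeMat u p)) r

/-- `ρ₀^*` commutes with `T_ℓ`. [cite: PollackStevens2011, §5 (p. 22)] -/
theorem specializeFun_Tl (ℓ : ℕ) (Φ : ℚ → Dist p) :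
    specializeFun (Tl ℓ Φ) = Tl₀ ℓ (specializeFun Φ) := by
  funext r
  change (slash Φ !![(ℓ : ℤ), 0; 0, 1] r + ∑ a ∈ Finset.range ℓ, slash Φ (heckeMat a ℓ) r) 0 =
    slash₀ (specializeFun Φ) !![(ℓ : ℤ), 0; 0, 1] r + ∑ a ∈ Finset.range ℓ, _
  rw [Pi.add_apply, Finset.sum_apply]
  exact congrArg₂ (· + ·) (congrFun (specializeFun_slash Φ _) r)
    (Finset.sum_congr rfl fun a _ => congrFun (specializeFun_slash Φ (heckeMat a ℓ)) r)

/-- `ρ₀^*` commutes with the involution. [cite: PollackStevens2011, §5 (p. 22)] -/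
theorem specializeFun_invol (Φ : ℚ → Dist p) :
    specializeFun (invol Φ) = invol₀ (specializeFun Φ) :=
  specializeFun_slash Φ _

/-- `ρ₀^*` is linear for scalars. [cite: PollackStevens2011, §5 (p. 22)] -/
theorem specializeFun_smul (c : ℚ_[p]) (Φ : ℚ → Dist p) :
    specializeFun (c • Φ) = c • specializeFun Φ := by
  funext r; rfl

/-- **The specialisation map `ρ₀^* : Symb_{Γ₀(M)}(𝐃) → Symb_{Γ₀(M)}(ℚ_p)`** (well defined by
`specializeFun_slash`). [cite: PollackStevens2011, §5 (pp. 21–22), the specialization map ρ_k^*] -/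
def specialize {M : ℕ} (Φ : OMSymb p M) : MSymb p M where
  toFun := specializeFun Φ.toFun
  slash₀_eq γ hγ := by rw [← specializeFun_slash, Φ.slash_eq γ hγ]

/-- Unfolding `specialize`. [cite: PollackStevens2011, §5 (p. 22)] -/
theorem specialize_toFun {M : ℕ} (Φ : OMSymb p M) :
    (specialize Φ).toFun = specializeFun Φ.toFun := rfl

/-- The power series of an upper-triangular matrix `(1 u; 0 q)` is the polynomial `(u + q z)ʲ`:
its `n`-th coefficient is `(j choose n) u^{j−n} qⁿ`. [cite: PollackStevens2011, proof of Thm. 5.12 (p. 27):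
"(Φ|U_p)(D)(zʳ) = ∑_a Φ(D_a)((a + pz)ʳ) = ∑_a ∑_j (r choose j) a^{r−j} pʲ Φ(D_a)(zʲ)"] -/
theorem coeff_moebiusPowSeries_heckeMat (u q : ℤ) (j n : ℕ) :
    coeff n (moebiusPowSeries (p := p) (heckeMat u q) j) =
      if n ≤ j then ((j.choose n : ℕ) : ℚ_[p]) * (u : ℚ_[p]) ^ (j - n) * (q : ℚ_[p]) ^ n
      else 0 := by
  have h00 : heckeMat u q 0 0 = 1 := rfl
  have h01 : heckeMat u q 0 1 = u := rfl
  have h10 : heckeMat u q 1 0 = 0 := rfl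
  have h11 : heckeMat u q 1 1 = q := rfl
  have hinv : ((1 : PowerSeries ℚ_[p]))⁻¹ = 1 := by
    have := PowerSeries.mul_inv_cancel (1 : PowerSeries ℚ_[p]) (by simp)
    rwa [one_mul] at this
  have hser : moebiusPowSeries (p := p) (heckeMat u q) j =
      ∑ m ∈ Finset.range (j + 1),
        C (((j.choose m : ℕ) : ℚ_[p]) * (u : ℚ_[p]) ^ (j - m) * (q : ℚ_[p]) ^ m) * X ^ m := by
    rw [moebiusPowSeries, h00, h01, h10, h11]
    simp only [Int.cast_one, map_one, Int.cast_zero, map_zero, zero_mul, add_zero, hinv, mul_one]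
    rw [add_comm, add_pow]
    refine Finset.sum_congr rfl fun m _ => ?_
    rw [mul_pow, ← map_pow, ← map_pow, ← map_natCast (C (R := ℚ_[p])), map_mul, map_mul]
    ring
  rw [hser, map_sum]
  simp_rw [PowerSeries.coeff_C_mul_X_pow]
  rw [Finset.sum_ite_eq]
  by_cases h : n ≤ j
  · rw [if_pos (Finset.mem_range.2 (Nat.lt_succ_of_le h)), if_pos h]
  · rw [if_neg (fun h' => h (Nat.le_of_lt_succ (Finset.mem_range.1 h'))), if_neg h]

/-- **Upper-triangular matrices act by finite sums** (no convergence question):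
`(μ|₀(1 u; 0 q))(zʲ) = ∑_{n ≤ j} (j choose n) u^{j−n} qⁿ μ(zⁿ)`.
[cite: PollackStevens2011, proof of Thm. 5.12 (p. 27)] -/
theorem act_heckeMat (μ : Dist p) (u q : ℤ) (j : ℕ) :
    μ.act (heckeMat u q) j = ∑ n ∈ Finset.range (j + 1),
      ((j.choose n : ℕ) : ℚ_[p]) * (u : ℚ_[p]) ^ (j - n) * (q : ℚ_[p]) ^ n * μ n := by
  unfold Dist.act
  rw [tsum_eq_sum (s := Finset.range (j + 1))]
  · refine Finset.sum_congr rfl fun n hn => ?_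
    rw [coeff_moebiusPowSeries_heckeMat, if_pos (by simpa [Nat.lt_succ_iff] using hn)]
  · intro n hn
    rw [coeff_moebiusPowSeries_heckeMat, if_neg (by simpa [Nat.lt_succ_iff] using hn), zero_mul]

/-- The `0`-th coset moment: `∫_{a+pⁿℤ_p} dμ = β⁻ⁿ · ρ₀(Φ({∞} − {a/pⁿ}))`.
[cite: PollackStevens2011, Prop. 6.3 proof (pp. 30–31)] -/
theorem cosetMoments_apply_zero (Φ : ℚ → Dist p) (β : ℚ_[p]) (n : ℕ) (a : ZMod (p ^ n)) :
    cosetMoments Φ β n a 0 = β⁻¹ ^ n * specializeFun Φ ((a.val : ℚ) / (p : ℚ) ^ n) := by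
  simp [cosetMoments, act_apply_zero, specializeFun, Dist.totalMass]

/-- **Consistency with the tree's Mazur–Tate–Teitelbaum measure**: if `ρ₀^*(Φ) = φ_β` then the
values of `μ = Φ({∞} − {0})` on the compact opens `a + pⁿ⁺¹ℤ_p` are those of `msdMeasure f β`:
`β^{−(n+1)} φ_β(a/pⁿ⁺¹) = β^{−(n+1)}[a/pⁿ⁺¹]⁺ − β^{−(n+2)}[a/pⁿ]⁺ = μ_{f,β}(a + pⁿ⁺¹ℤ_p)` — the
`β`-measure on compact opens is already in the tree; `Φ` supplies its extension to locally analytic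
test functions (all coset moments), which for critical slope the values on opens do NOT determine
(PS §6.4). [cite: PollackStevens2011, §6.4 (p. 31) and Prop. 6.3 proof] [cite: MazurTateTeitelbaum1986Invent, §I.10 (10.1)] -/
theorem cosetMoments_apply_zero_eq_msdMeasure {N : ℕ} (f : CuspForm (Gamma0 N) 2) (β : ℚ_[p])
    (Φ : ℚ → Dist p) (hΦ : specializeFun Φ = phiBeta f β) (n : ℕ) (a : ZMod (p ^ (n + 1))) :
    cosetMoments Φ β (n + 1) a 0 = msdMeasure f β (n + 1) a := by
  rw [cosetMoments_apply_zero, hΦ]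
  have hp : (p : ℚ) ≠ 0 := Nat.cast_ne_zero.2 (Fact.out : p.Prime).ne_zero
  have hmul : ∀ x : ℚ, (p : ℚ) * (x / (p : ℚ) ^ (n + 1)) = x / (p : ℚ) ^ n := fun x => by
    rw [pow_succ]; field_simp
  simp only [phiBeta, msdMeasure, hmul]
  ring

/-- `μ|₀γ` of the zero distribution is zero. [cite: PollackStevens2011, §3.3 (p. 19)] -/
theorem zero_act (γ : Matrix (Fin 2) (Fin 2) ℤ) : (0 : Dist p).act γ = 0 := by
  funext j
  simp [Dist.act]

/-- The zero function is fixed by every slash operator. [cite: PollackStevens2011, §2.1 (p. 7)] -/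
theorem slash_zero (γ : Matrix (Fin 2) (Fin 2) ℤ) : slash (0 : ℚ → Dist p) γ = 0 := by
  funext r
  simp only [slash]
  have : ∀ x : Option ℚ, extInfty (0 : ℚ → Dist p) x = 0 := fun x => by cases x <;> rfl
  rw [this, this, sub_zero, zero_act]
  rfl

/-- **Non-vacuity: the zero overconvergent symbol** (the spaces `Symb_{Γ₀(M)}(𝐃)` are `ℚ_p`-vector
spaces; no instance is declared in this statement file). [cite: PollackStevens2011, §2.1 (p. 7)] -/
def OMSymb.zero (M : ℕ) : OMSymb p M where
  toFun := 0
  isBounded _ := ⟨0, fun j => by simp⟩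
  slash_eq γ _ := slash_zero _

/-- The zero classical symbol. [cite: PollackStevens2011, §2.1 (p. 7)] -/
def MSymb.zero (M : ℕ) : MSymb p M where
  toFun := 0
  slash₀_eq γ _ := by
    funext r
    have : ∀ x : Option ℚ, extInfty (0 : ℚ → ℚ_[p]) x = 0 := fun x => by cases x <;> rfl
    simp [slash₀, this]

/-- The action is homogeneous: `(c μ)|₀γ = c (μ|₀γ)`. [cite: PollackStevens2011, §3.3 (p. 19)] -/
theorem smul_act (c : ℚ_[p]) (μ : Dist p) (γ : Matrix (Fin 2) (Fin 2) ℤ) :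
    (c • μ).act γ = c • μ.act γ := by
  funext j
  simp only [Dist.act, Pi.smul_apply, smul_eq_mul]
  rw [← tsum_mul_left]
  exact tsum_congr fun n => by ring

/-- The slash operators are homogeneous. [cite: PollackStevens2011, §2.1 (p. 7)] -/
theorem slash_smul (c : ℚ_[p]) (Φ : ℚ → Dist p) (γ : Matrix (Fin 2) (Fin 2) ℤ) :
    slash (c • Φ) γ = c • slash Φ γ := by
  funext r
  have hext : ∀ x : Option ℚ, extInfty (c • Φ) x = c • extInfty Φ x := fun x => by
    cases x
    · simp [extInfty]
    · rfl
  simp only [slash, Pi.smul_apply, hext, ← smul_sub, smul_act]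

/-- **Scalar multiples of overconvergent symbols** (the eigen"spaces" of §8 are lines in this sense;
no `Module` instance is declared in a statement file). [cite: PollackStevens2011, §2.1 (p. 7)] -/
def OMSymb.smul {M : ℕ} (c : ℚ_[p]) (Φ : OMSymb p M) : OMSymb p M where
  toFun := c • Φ.toFun
  isBounded r := by
    obtain ⟨C, hC⟩ := Φ.isBounded r
    refine ⟨‖c‖ * C, fun j => ?_⟩
    calc ‖(c • Φ.toFun) r j‖ = ‖c‖ * ‖Φ.toFun r j‖ := by simp [norm_mul]
      _ ≤ ‖c‖ * C := mul_le_mul_of_nonneg_left (hC j) (norm_nonneg c)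
  slash_eq γ hγ := by rw [slash_smul, Φ.slash_eq γ hγ]

/-- Unfolding `OMSymb.smul`. [cite: PollackStevens2011, §2.1 (p. 7)] -/
theorem OMSymb.smul_toFun {M : ℕ} (c : ℚ_[p]) (Φ : OMSymb p M) :
    (OMSymb.smul c Φ).toFun = c • Φ.toFun := rfl

/-- `U_p` is homogeneous. [cite: PollackStevens2011, §2.1 (p. 8)] -/
theorem Up_smul (c : ℚ_[p]) (Φ : ℚ → Dist p) : Up (c • Φ) = c • Up Φ := by
  funext r
  simp only [Up, slash_smul, Pi.smul_apply, Finset.smul_sum]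

/-- `T_ℓ` is homogeneous. [cite: PollackStevens2011, §2.1 (p. 8)] -/
theorem Tl_smul (ℓ : ℕ) (c : ℚ_[p]) (Φ : ℚ → Dist p) : Tl ℓ (c • Φ) = c • Tl ℓ Φ := by
  funext r
  simp only [Tl, slash_smul, Pi.smul_apply, Finset.smul_sum, smul_add]

/-- The involution is homogeneous. [cite: PollackStevens2011, §2.1 (p. 8)] -/
theorem invol_smul (c : ℚ_[p]) (Φ : ℚ → Dist p) : invol (c • Φ) = c • invol Φ :=
  slash_smul c Φ _

/-! ## §8 The named facts (cite-only `def … : Prop`; nothing asserted) -/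

/-- **F1₀ — Stevens' control theorem at slope `< 1` (Pollack–Stevens Thm. 5.12 at `k = 0`,
eigen form).**  Let `p ∤ N` and `φ ∈ Symb_{Γ₀(Np)}(ℚ_p)` be a `U_p`-eigensymbol, `φ|U_p = α φ`,
of slope `v_p(α) < 1 = k + 1`.  Then there is a UNIQUE `Φ ∈ Symb_{Γ₀(Np)}(𝐃)` with `Φ|U_p = α Φ`
and `ρ₀^*(Φ) = φ`.  (Thm. 5.12: "the specialization map restricted to the subspace where `U_p` acts
with slope strictly less than `k+1` is an isomorphism" `Symb_{Γ₀}(𝐃_k)^{(<k+1)} ⥲ Symb_{Γ₀}(V_k)^{(<k+1)}`,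
`Γ₀ = Γ ∩ Γ₀(p)`, `Γ` of level `N`, `p ∤ N`; the eigen form follows since `ρ₀^*` is Hecke-equivariant
and a `U_p`-eigenvector of slope `< 1` lies in the slope-`< 1` subspace.)  For `v_p(α) = 0` and
`φ = φ_α` the lift's `Φ_α({∞} − {0})|_{ℤ_p^×}` is the Mazur–Tate–Teitelbaum `p`-adic `L`-function
(Prop. 6.3; tree `padicLFunction f α`). Cite-only named fact. [cite: PollackStevens2011, Thm. 1.1 (p. 2) and Thm. 5.12 (p. 27), k = 0; Prop. 6.3 (p. 30)] -/
def stevensControl_slope_lt_one : Prop :=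
  ∀ (p : ℕ) [Fact p.Prime] (N : ℕ), ¬ p ∣ N →
    ∀ (φ : MSymb p (N * p)) (α : ℚ_[p]), α ≠ 0 → Padic.valuation α < 1 →
      Up₀ φ.toFun = α • φ.toFun →
      ∃! Φ : OMSymb p (N * p), Up Φ.toFun = α • Φ.toFun ∧ specializeFun Φ.toFun = φ.toFun

/-- **The tree's stand-in for "`f_β` is not `θ`-critical"**: the specialisation map is INJECTIVE on
the eigenspace `Symb_{Γ₀(Np)}(𝐃)^+[f_β]`.  For a decent cuspidal refinement `f_β` this is equivalent to
`f_β ∉ im(θ_k)` and to "`ρ_f|_{D_p}` is not the direct sum of two characters" ([Bellaiche2012, Thm. 1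
(i)⇔(iii) with Prop. 2.12 (iii)⇔(v)], [PollackStevens2011, Thm. 5.14]); it FAILS for CM curves
(there `f_β` is `θ`-critical and `ρ₀^*` kills the eigenline: [PollackStevens2011, Rem. 5.15 (2)],
[Bellaiche2012, Prop. 2.14 (b) with Thm. 1 (i)⇒(iii)]) and is EXPECTED (not known: Greenberg's question)
for non-CM ordinary `W` ([Bellaiche2012, Prop. 2.14 (a)]).  A hypothesis of the critical-slope facts, never
asserted. [cite: Bellaiche2012, Thm. 1 and Prop. 2.12 (arXiv:0912.2925 pp. 5, 12–13)] [cite: PollackStevens2011, Thm. 5.14 (p. 28)] -/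
def SpecializeInjOnEigenspace (W : WeierstrassCurve ℚ) (N : ℕ) (β : ℚ_[p]) : Prop :=
  ∀ Φ Φ' : OMSymb p (N * p), IsEigen W N β Φ → IsEigen W N β Φ' →
    specializeFun Φ.toFun = specializeFun Φ'.toFun → Φ.toFun = Φ'.toFun

/-- **F2₀(a) — Bellaïche 2012, Theorem 1 (dimension one of the eigenspace), weight two, trivial
nebentypus.**  Let `f` be the newform of the elliptic curve `W/ℚ` at level `N`, `p ∤ N`, and `β ∈ ℚ_p`
a root of `X² − a_p X + p` (a refinement `f_β`, of level `Γ₀(Np)`).  Assume `f_β` is DECENT through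
one of Bellaïche's printed sufficient conditions Prop. 2.15 (iii) ("`f` not CM, and `f` cuspidal or
special at all primes dividing `N` (e.g. trivial nebentypus and `N` square-free)") or (iv) ("`f` is
CM"): here `Squarefree N ∨ W.HasCM`.  Then the eigenspace `Symb_{Γ₀(Np)}(𝐃)^+[f_β]` is
ONE-dimensional: there is a non-zero `Φ₀` in it and every member is a scalar multiple of `Φ₀`.
(Thm. 1 is printed for `Γ = Γ₁(N) ∩ Γ₀(p)` and the eigenspace, after `⊗ ℚ̄_p`, of
`ℋ = ℤ[(T_ℓ)_{ℓ ∤ pN}, U_p, (⟨a⟩)_{a ∈ (ℤ/N)^×}]` (Bel12 §1.2, p. 4); for trivial nebentypus the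
`⟨a⟩ = 1`-eigenvectors are the `Γ₀(Np)`-invariant symbols, so the eigenspace is `IsEigen W N β` read in
`Symb_{Γ₀(Np)}(𝐃)^+` — the system of eigenvalues `(a_ℓ(W), β)` is `ℚ_p`-rational, so its dimension
over `ℚ_p` is the printed dimension over `ℚ̄_p`.)
Scope `p ≠ 2`: Bellaïche's standing hypothesis "a prime number `p` that we shall assume odd and prime to
`N`" (arXiv:0912.2925 p. 3).
TODO(general form): every decent `f_β` (Def. 1: `H¹_g(G_ℚ, ad ρ_f) = 0` is not expressible in the
tree); `p = 2`. Cite-only named fact. [cite: Bellaiche2012, Thm. 1, Def. 1 and Prop. 2.15 (iii)–(iv) (arXiv:0912.2925 pp. 3, 5, 13)] -/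
def bellaiche2012_thm1_eigenspace_dim_one : Prop :=
  ∀ (p : ℕ) [Fact p.Prime], p ≠ 2 → ∀ (W : WeierstrassCurve ℚ) [W.IsElliptic] {N : ℕ} [NeZero N]
    (f : CuspForm (Gamma0 N) 2), IsNewformOf W f → ¬ p ∣ N → (Squarefree N ∨ W.HasCM) →
    ∀ β : ℚ_[p], β ^ 2 - (W.LFunction p : ℚ_[p]) * β + p = 0 →
      ∃ Φ₀ : OMSymb p (N * p), IsEigen W N β Φ₀ ∧ Φ₀.toFun ≠ 0 ∧
        ∀ Φ : OMSymb p (N * p), IsEigen W N β Φ → ∃ c : ℚ_[p], Φ.toFun = c • Φ₀.toFun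

/-- **F2₀(b) — the critical-slope eigen-lift (Pollack–Stevens Thm. 5.14 with Def. 6.4; Bellaïche
Thm. 1).**  Let `f` be the newform of `W/ℚ` at level `N`, `p ∤ N` a good ORDINARY prime, and
`β ∈ ℚ_p` the root of `X² − a_p X + p` of CRITICAL slope `v_p(β) = 1 = k + 1`.  If `f_β` is not
`θ`-critical — here: the specialisation map is injective on `Symb_{Γ₀(Np)}(𝐃)^+[f_β]`
(`SpecializeInjOnEigenspace`), which for a DECENT `f_β` (as in F2₀(a): `Squarefree N ∨ W.HasCM`,
Bel12 Prop. 2.15 (iii)/(iv)) is equivalent to `f_β ∉ im(θ_k)` (Bel12 Thm. 1 (i)⇔(iii): the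
eigenline is killed iff `f_β` is critical; Prop. 2.12 (iii)⇔(v) for cuspidal `f`) — then there is a
Hecke eigensymbol `Φ_β ∈ Symb_{Γ₀(Np)}(𝐃)^+` for `f_β` specialising to `φ_β` (Thm. 5.14:
"`Symb_{Γ₀}(𝐃_k)_{(f)} ⥲ Symb_{Γ₀}(V_k)_{(f)}` is an isomorphism if and only if `f ∉ im(θ_k)`", an
`ℋ`-equivariant isomorphism, so the preimage of the eigensymbol `φ_β` is an eigensymbol; Def. 6.4: "Let
`Φ_f` be the unique overconvergent eigensymbol (of Theorem 5.14) which specializes to `φ_f`"); it is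
then unique (`IsEigenLift.unique`, proved).  Scope `p ≠ 2`: the translation of "not `θ`-critical"
through Bellaïche's Thm. 1 is under his standing hypothesis "`p` … odd and prime to `N`" (arXiv:0912.2925
p. 3); the Galois-side door without decency is `pollackStevens2013_eigenLiftFull_of_not_isLocallySplitAt`
(`OverconvergentModularSymbolsWeightTwoEigenLift`).  TODO(general form): every decent `f_β` (Bel12
Prop. 2.15 (i), (ii) — e.g. the residually reducible "Eisenstein" primes with distinct diagonal
characters — are not expressible in the tree today); `p = 2`.  Cite-only named fact.
[cite: PollackStevens2011, Thm. 5.14 (p. 28) and Def. 6.4 (p. 31)] [cite: PollackStevens2013, Thm. 5.14 of PS2011 is "established in [17]"]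
[cite: Bellaiche2012, Thm. 1, Prop. 2.12 and Prop. 2.15 (arXiv:0912.2925 pp. 5, 12–13)] -/
def pollackStevens_criticalSlope_eigenLift : Prop :=
  ∀ (p : ℕ) [Fact p.Prime], p ≠ 2 → ∀ (W : WeierstrassCurve ℚ) [W.IsElliptic] {N : ℕ} [NeZero N]
    (f : CuspForm (Gamma0 N) 2), IsNewformOf W f → ¬ p ∣ N → (Squarefree N ∨ W.HasCM) →
    ¬ (p : ℤ) ∣ W.LFunction p →
    ∀ β : ℚ_[p], β ^ 2 - (W.LFunction p : ℚ_[p]) * β + p = 0 → Padic.valuation β = 1 →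
      SpecializeInjOnEigenspace W N β →
      ∃ Φ : OMSymb p (N * p), IsEigenLift W f β Φ

/-! ## §9 Proved consequences: uniqueness of the critical lift; the critical `p`-adic `L`-function -/

/-- An eigen-lift is in the eigenspace. [cite: PollackStevens2011, Def. 6.4 (p. 31)] -/
theorem IsEigenLift.isEigen {W : WeierstrassCurve ℚ} {N : ℕ} {f : CuspForm (Gamma0 N) 2} {β : ℚ_[p]}
    {Φ : OMSymb p (N * p)} (h : IsEigenLift W f β Φ) : IsEigen W N β Φ :=
  ⟨h.invol_eq, h.up_eq, h.tl_eq⟩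

/-- The eigenspace is closed under scalars. [cite: Bellaiche2012, Thm. 1 (p. 5)] -/
theorem IsEigen.smul {W : WeierstrassCurve ℚ} {N : ℕ} {β : ℚ_[p]} {Φ : OMSymb p (N * p)}
    (h : IsEigen W N β Φ) (c : ℚ_[p]) : IsEigen W N β (OMSymb.smul c Φ) := by
  refine ⟨?_, ?_, ?_⟩
  · rw [OMSymb.smul_toFun, invol_smul, h.invol_eq]
  · rw [OMSymb.smul_toFun, Up_smul, h.up_eq, smul_comm]
  · intro ℓ hℓ hℓN
    rw [OMSymb.smul_toFun, Tl_smul, h.tl_eq ℓ hℓ hℓN, smul_comm]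

/-- **Uniqueness of `Φ_β`** ("the unique overconvergent eigensymbol … which specializes to `φ_f`")
under the non-`θ`-criticality hypothesis. [cite: PollackStevens2011, Def. 6.4 (p. 31)] -/
theorem IsEigenLift.unique {W : WeierstrassCurve ℚ} {N : ℕ} {f : CuspForm (Gamma0 N) 2} {β : ℚ_[p]}
    (hθ : SpecializeInjOnEigenspace W N β) {Φ Φ' : OMSymb p (N * p)} (h : IsEigenLift W f β Φ)
    (h' : IsEigenLift W f β Φ') : Φ.toFun = Φ'.toFun :=
  hθ Φ Φ' h.isEigen h'.isEigen (by rw [h.specialize_eq, h'.specialize_eq])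

/-- **The critical `p`-adic `L`-function of `W` at `(p, β)` in the moment model (PS Def. 6.4):**
`μ_{f_β} := Φ_β({∞} − {0})|_{ℤ_p^×}`, presented by its coset moments
`(n, a, j) ↦ ∫_{a + pⁿℤ_p} zʲ dμ_{f_β} = β⁻ⁿ Φ_β({∞} − {a/pⁿ})((a + pⁿz)ʲ)` (`n ≥ 1`, `a` prime to
`p` for the restriction to `ℤ_p^×`).  By `IsEigenLift.unique` it does not depend on the choice of the
eigen-lift `Φ`; its values on compact opens are the tree's `msdMeasure f β`
(`cosetMoments_apply_zero_eq_msdMeasure`).  The power series `L_p(f_β, T)` in the cyclotomic variable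
(PS §9.1) is left to the definition item `defn-CriticalSlopePAdicLFunction`, which must integrate the
Mahler functions of `log_γ⟨x⟩` against ALL coset moments (the distribution is `1`-admissible, not a
measure). [cite: PollackStevens2011, Def. 6.4 (p. 31) and §9.1 (p. 41)] -/
def criticalPAdicLDist {M : ℕ} (Φ : OMSymb p M) (β : ℚ_[p]) (n : ℕ) (a : ZMod (p ^ n)) : Dist p :=
  cosetMoments Φ.toFun β n a

/-! ## §10 The interpolation property at finite-order characters (PS Prop. 6.5 at `k = j = 0`) — PROVED
as the formal consequence of `ρ₀^*(Φ) = φ_β` that Pollack–Stevens say it is -/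

/-- Orthogonality behind Prop. 6.5: a PRIMITIVE Dirichlet character mod `p^{m+1}` sums to zero against
any function that is periodic mod `p^m` (there is a unit `u ≡ 1 (mod p^m)` with `χ(u) ≠ 1`, and the
sum is invariant under `a ↦ ua`). [cite: PollackStevens2011, Prop. 6.5 (p. 31) ("a formal consequence")] -/
theorem sum_mul_eq_zero_of_isPrimitive {R : Type*} [Field R] {m : ℕ}
    (χ : DirichletCharacter R (p ^ (m + 1))) (hχ : χ.IsPrimitive) (g : ZMod (p ^ (m + 1)) → R)
    (hg : ∀ a b : ZMod (p ^ (m + 1)),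
      ZMod.castHom (pow_dvd_pow p m.le_succ) (ZMod (p ^ m)) a =
        ZMod.castHom (pow_dvd_pow p m.le_succ) (ZMod (p ^ m)) b → g a = g b) :
    ∑ a : ZMod (p ^ (m + 1)), χ a * g a = 0 := by
  have hp : p.Prime := Fact.out
  haveI : NeZero (p ^ (m + 1)) := ⟨pow_ne_zero _ hp.ne_zero⟩
  have hd : p ^ m ∣ p ^ (m + 1) := pow_dvd_pow p m.le_succ
  -- `χ` does not factor through `p^m`
  have hnot : ¬ χ.FactorsThrough (p ^ m) := by
    intro hfac
    have h1 : χ.conductor ∣ p ^ m :=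
      DirichletCharacter.conductor_dvd_of_mem_conductorSet χ
        ((DirichletCharacter.mem_conductorSet_iff χ).2 hfac)
    rw [(DirichletCharacter.isPrimitive_def χ).1 hχ] at h1
    have h2 := Nat.le_of_dvd (pow_pos hp.pos m) h1
    have h3 : p ^ m < p ^ (m + 1) := Nat.pow_lt_pow_right hp.one_lt (Nat.lt_succ_self m)
    omega
  rw [DirichletCharacter.factorsThrough_iff_ker_unitsMap hd] at hnot
  obtain ⟨u, hu1, hu⟩ : ∃ u : (ZMod (p ^ (m + 1)))ˣ, ZMod.unitsMap hd u = 1 ∧ χ (u : ZMod _) ≠ 1 := by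
    by_contra h
    push Not at h
    exact hnot fun u hu => by
      rw [MonoidHom.mem_ker] at hu ⊢
      exact Units.ext (by simpa using h u hu)
  -- `u ≡ 1 (mod p^m)`, so `g (u a) = g a`
  have hcast : ZMod.castHom hd (ZMod (p ^ m)) (u : ZMod (p ^ (m + 1))) = 1 := by
    have := congrArg (fun x : (ZMod (p ^ m))ˣ => (x : ZMod (p ^ m))) hu1
    simpa [ZMod.unitsMap_def] using this
  have hgu : ∀ a, g ((u : ZMod (p ^ (m + 1))) * a) = g a := fun a =>
    hg _ _ (by rw [map_mul, hcast, one_mul])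
  -- reindex the sum by `a ↦ u a`
  have hre : ∑ a : ZMod (p ^ (m + 1)), χ a * g a =
      ∑ a : ZMod (p ^ (m + 1)), χ ((u : ZMod _) * a) * g ((u : ZMod _) * a) :=
    (Fintype.sum_equiv u.mulLeft _ _ fun a => rfl).symm
  have hS : ∑ a : ZMod (p ^ (m + 1)), χ a * g a = χ (u : ZMod _) * ∑ a : ZMod (p ^ (m + 1)), χ a * g a := by
    conv_lhs => rw [hre]
    rw [Finset.mul_sum]
    refine Finset.sum_congr rfl fun a _ => ?_
    rw [map_mul, hgu, mul_assoc]
  have h1 : (1 - χ (u : ZMod _)) * ∑ a : ZMod (p ^ (m + 1)), χ a * g a = 0 := by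
    rw [sub_mul, one_mul, ← hS, sub_self]
  rcases mul_eq_zero.1 h1 with h | h
  · exact absurd (sub_eq_zero.1 h).symm hu
  · exact h

/-- The value `μ(χ) = ∑_{a mod pⁿ} χ(a) ∫_{a+pⁿℤ_p} dμ ∈ ℂ_p` of the distribution
`μ = Φ({∞} − {0})` (coset moments for the eigenvalue `β`) at a `ℂ_p`-valued Dirichlet character
`χ` mod `pⁿ` (`χ` vanishes off `(ℤ/pⁿ)^×`, so this is `μ|_{ℤ_p^×}(χ)`). [cite: PollackStevens2011, Prop. 6.5 (p. 31), left-hand side at j = 0] -/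
def charValue (Φ : ℚ → Dist p) (β : ℚ_[p]) {n : ℕ} (χ : DirichletCharacter ℂ_[p] (p ^ n)) : ℂ_[p] :=
  ∑ a : ZMod (p ^ n), χ a * algebraMap ℚ_[p] ℂ_[p] (cosetMoments Φ β n a 0)

/-- **Pollack–Stevens Prop. 6.5 at `k = j = 0`, in the tree's Birch currency — PROVED.**  If
`ρ₀^*(Φ) = φ_β` (e.g. `Φ = Φ_β`), then for every PRIMITIVE `χ` of conductor `pⁿ`, `n ≥ 1`,
`μ(χ) = β⁻ⁿ ∑_{a mod pⁿ} χ(a) [a/pⁿ]⁺_f` (`= β⁻ⁿ τ(χ) L(f, χ̄, 1)/Ω⁺` by Birch's formula, the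
tree's `ratTwistedSymbolSum_mul_plusPeriod`; PS: "`μ_f(χ) = β⁻ⁿ · 1/τ(χ⁻¹) · L(f, χ⁻¹, 1)/Ω_f`",
"a formal consequence of the fact that `Φ_f` is a `U_p`-eigensymbol lifting `φ_f`").  The term
`β⁻ⁿ⁻¹ ∑ χ(a)[a/pⁿ⁻¹]⁺` vanishes by `sum_mul_eq_zero_of_isPrimitive`; periodicity `[r + 1]⁺ = [r]⁺`
is the tree's named fact `ratPlusSymbol_add_intCast`, taken as a hypothesis.  Same shape as the
second clause of the tree's `IsPAdicLFunctionOf f p α` with `α ↦ β`.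
[cite: PollackStevens2011, Prop. 6.5 (p. 31)] [cite: MazurTateTeitelbaum1986Invent, §I.14 (14.3)] -/
theorem charValue_eq_of_specializeFun_eq {N : ℕ} [NeZero N] (f : CuspForm (Gamma0 N) 2)
    (hper : ratPlusSymbol_add_intCast f) (β : ℚ_[p]) (Φ : ℚ → Dist p)
    (hΦ : specializeFun Φ = phiBeta f β) {m : ℕ} (χ : DirichletCharacter ℂ_[p] (p ^ (m + 1)))
    (hχ : χ.IsPrimitive) :
    charValue Φ β χ = algebraMap ℚ_[p] ℂ_[p] (β⁻¹ ^ (m + 1)) * ratTwistedSymbolSum f χ := by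
  have hp : p.Prime := Fact.out
  have hp0 : (p : ℚ) ≠ 0 := Nat.cast_ne_zero.2 hp.ne_zero
  haveI : NeZero (p ^ (m + 1)) := ⟨pow_ne_zero _ hp.ne_zero⟩
  -- expand the coset moments through `φ_β`
  have hval : ∀ a : ZMod (p ^ (m + 1)), cosetMoments Φ β (m + 1) a 0 =
      β⁻¹ ^ (m + 1) * (ratPlusSymbol f ((a.val : ℚ) / (p ^ (m + 1) : ℕ)) : ℚ_[p]) -
        β⁻¹ ^ (m + 2) * (ratPlusSymbol f ((a.val : ℚ) / (p : ℚ) ^ m) : ℚ_[p]) := by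
    intro a
    rw [cosetMoments_apply_zero, hΦ, Nat.cast_pow]
    have hmul : ∀ x : ℚ, (p : ℚ) * (x / (p : ℚ) ^ (m + 1)) = x / (p : ℚ) ^ m := fun x => by
      rw [pow_succ]; field_simp
    simp only [phiBeta]
    rw [hmul]
    ring
  -- the second term is periodic mod `p^m`, hence orthogonal to the primitive `χ`
  have hper' : ∀ a b : ZMod (p ^ (m + 1)),
      ZMod.castHom (pow_dvd_pow p m.le_succ) (ZMod (p ^ m)) a =
        ZMod.castHom (pow_dvd_pow p m.le_succ) (ZMod (p ^ m)) b →
      (algebraMap ℚ_[p] ℂ_[p] (ratPlusSymbol f ((a.val : ℚ) / (p : ℚ) ^ m) : ℚ_[p]) =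
        algebraMap ℚ_[p] ℂ_[p] (ratPlusSymbol f ((b.val : ℚ) / (p : ℚ) ^ m) : ℚ_[p])) := by
    intro a b hab
    have hab' : (a.val : ZMod (p ^ m)) = (b.val : ZMod (p ^ m)) := by
      have h := hab
      rw [ZMod.castHom_apply, ZMod.castHom_apply, ZMod.cast_eq_val, ZMod.cast_eq_val] at h
      exact h
    rw [ZMod.natCast_eq_natCast_iff'] at hab'
    have key : ∀ c : ZMod (p ^ (m + 1)), ratPlusSymbol f ((c.val : ℚ) / (p : ℚ) ^ m) =
        ratPlusSymbol f (((c.val % p ^ m : ℕ) : ℚ) / (p : ℚ) ^ m) := by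
      intro c
      obtain ⟨k, hk⟩ : ∃ k : ℕ, c.val = c.val % p ^ m + p ^ m * k :=
        ⟨c.val / p ^ m, (Nat.mod_add_div _ _).symm⟩
      have hq : ((c.val : ℚ) / (p : ℚ) ^ m) =
          ((c.val % p ^ m : ℕ) : ℚ) / (p : ℚ) ^ m + ((k : ℤ) : ℚ) := by
        have hpm : (p : ℚ) ^ m ≠ 0 := pow_ne_zero _ hp0
        have hc : (c.val : ℚ) = ((c.val % p ^ m : ℕ) : ℚ) + (p : ℚ) ^ m * (k : ℚ) := by
          exact_mod_cast hk
        rw [hc, Int.cast_natCast]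
        field_simp
      rw [hq, hper]
    rw [key a, key b, hab']
  have hvanish : ∑ a : ZMod (p ^ (m + 1)), χ a *
      algebraMap ℚ_[p] ℂ_[p] (ratPlusSymbol f ((a.val : ℚ) / (p : ℚ) ^ m) : ℚ_[p]) = 0 :=
    sum_mul_eq_zero_of_isPrimitive χ hχ _ hper'
  -- assemble
  unfold charValue ratTwistedSymbolSum
  simp_rw [hval, map_sub, map_mul, mul_sub, Finset.sum_sub_distrib]
  have h2 : ∑ a : ZMod (p ^ (m + 1)), χ a * (algebraMap ℚ_[p] ℂ_[p] (β⁻¹ ^ (m + 2)) *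
      algebraMap ℚ_[p] ℂ_[p] (ratPlusSymbol f ((a.val : ℚ) / (p : ℚ) ^ m) : ℚ_[p])) = 0 := by
    have : ∑ a : ZMod (p ^ (m + 1)), χ a * (algebraMap ℚ_[p] ℂ_[p] (β⁻¹ ^ (m + 2)) *
        algebraMap ℚ_[p] ℂ_[p] (ratPlusSymbol f ((a.val : ℚ) / (p : ℚ) ^ m) : ℚ_[p])) =
        algebraMap ℚ_[p] ℂ_[p] (β⁻¹ ^ (m + 2)) * ∑ a : ZMod (p ^ (m + 1)), χ a *
          algebraMap ℚ_[p] ℂ_[p] (ratPlusSymbol f ((a.val : ℚ) / (p : ℚ) ^ m) : ℚ_[p]) := by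
      rw [Finset.mul_sum]
      exact Finset.sum_congr rfl fun a _ => by ring
    rw [this, hvanish, mul_zero]
  rw [h2, sub_zero, Finset.mul_sum]
  refine Finset.sum_congr rfl fun a _ => ?_
  rw [map_ratCast]
  ring

end Literature.NumberTheory.EllipticCurves.OMSWeightTwo

end
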